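import Summits.ResolutionOfSingularities.ResolutionOfSingularities.Theorems.FrobeniusClosingSteerHullVocabulary
import Summits.ResolutionOfSingularities.ResolutionOfSingularities.Theorems.FrobeniusClosingSteerSwitchingSetup
import Summits.ResolutionOfSingularities.ResolutionOfSingularities.Theorems.FrobeniusClosingSteerResonanceAlternativeLiteral
import Literature.AlgebraicGeometry.Resolution.ShannonHullParameter
import Summits.ResolutionOfSingularities.ResolutionOfSingularities.Theorems.FrobeniusClosingSteerHullParameter
import Mathlib.RingTheory.KrullDimension.Field
import HarnessLib

/-!
# Crux `Steer` (stmt-ResolutionOfSingularities-16345), chain W4.1, NSCᴹ line — **`NearFarDichotomy`** (idea-2 card 3, SUPPORT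
# piece «in print») from HLOST Prop. 3.8 (the named fact `HeinzerEtAl2015HullParameterExists`)

OURS (campaign `res-hironaka`, rung L ★L-G4, slot W4.1; seat res-type-028, self-dealt under director-resolution's IDLE-HEADROOM
ORDER 2026-08-27T08:35:13Z (1)(c) after W4.1 U2 / RESCUE T15, announced STATUS 09:31:18Z / 09:45:01Z; res-L0-w41-idea-2 g7
09:44:13Z «`IsHullParameter` clause right = HLOST Prop 3.8, fact-first»; NOT a statement of the manuscript under review
[claim: Hironaka2017, status: under-review]; AI-produced, weaker than expert review).  Theses-free, definition-free helper for the
registered residual `stub_nonSwitchingCoreM` of the line of record `Cruxes/Steer/Lines/switching_dichotomy.lean` (holder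
res-L0-w41-lead-1) through res-L0-w41-idea-2's kernel-checked dévissage (Sketch-idea-2f 64403cb98dc5de30 / -2h §G5)

  `monomialReachAlong_of_dichotomy_far : NearFarDichotomy → FarMonomialReach → MonomialReachAlong`,

whose SUPPORT input is

> **`NearFarDichotomy`** (sketch l.641): for `A₀ ⊆ O` finitely generated, regular and of Krull dimension `≥ 3` at the centre of
> `O`, and a radicand `t ^ p ∈ A₀` with `t ≠ 0`, there are a point sequence `R` along `O` from `(A₀)_{𝔪_O ∩ A₀}`, a HULL
> PARAMETER `x` (`IsHullParameter`: a regular parameter of some member with `xS` primary for the maximal ideal of `S = ⋃ Rᵢ`),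
> and `t ^ p` is NEAR or FAR for `(R, x)`.

Content = existence of the point sequence (tree: `stub_switchingSetup`) + HLOST Prop. 3.8 (the named fact
`Literature.AlgebraicGeometry.Resolution.HeinzerEtAl2015HullParameterExists`, which is Prop. 3.8 in print shape: Setting 3.1 asks
every member to have dimension `≥ 2`) + the definitional dichotomy `Hull.isNear_or_isFar`.  The DEGENERATE TAIL (some member of
dimension `≤ 1`, outside Setting 3.1) is handled here for itself, with res-type-058's lemmas (`Resonance.eq_of_le_of_ringKrullDim_le_one`,
`Resonance.exists_mul_eq_pow_of_isDiscreteValuationRing`, p519893): the sequence is stationary at a DVR, which IS the Shannon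
extension, and its uniformiser is a hull parameter.

Main theorem `nearFarDichotomy_of_hullParameterExists (hH : HeinzerEtAl2015HullParameterExists)` has as TYPE the literal body of the
sketch's `def NearFarDichotomy : Prop` over the tree vocabulary `Hull.IsPointSequenceAlong` / `Hull.IsHullParameter` / `Hull.IsNear` /
`Hull.IsFar` (p517308), so the skeleton closes the piece by `exact nearFarDichotomy_of_hullParameterExists hH` — CONDITIONAL on the
named fact; the APPENDED `nearFarDichotomy` (below) is the UNCONDITIONAL form, fed with the kernel proof of HLOST Prop. 3.8 `heinzerEtAl2015HullParameterExists_holds` (`…SteerHullParameter.lean`).  No `sorry`, no new definition.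
[cite: HeinzerEtAl2015, Prop. 3.8] [cite: Cutkosky2014, §2.2] [folklore]
-/

noncomputable section

-- `Summit.<S>.<S>.…` duplicates the summit name by design (single-problem summit).
set_option linter.dupNamespace false
set_option autoImplicit false

namespace Summit.ResolutionOfSingularities.ResolutionOfSingularities.Theorems.SwitchingDichotomy.Hull

open IsLocalRing
open Literature.AlgebraicGeometry.Resolution
open Summit.ResolutionOfSingularities.ResolutionOfSingularities.Theorems.SwitchingDichotomy.Resonance
  (eq_of_le_of_ringKrullDim_le_one exists_mul_eq_pow_of_isDiscreteValuationRing isRegularLocalRing_of_pointSequence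
    dominated_of_pointSequence)

variable {k K : Type} [Field k] [Field K] [Algebra k K]

/-! ## Bookkeeping: a base of positive dimension at the centre has a nonzero element of positive value -/

/-- If `A₀ ⊆ O` is regular of Krull dimension `> 2` (indeed `≠ 0` suffices) at the centre of `O`, some nonzero element of `A₀` has
positive `O`-value — so the point sequence of `(A₀)_{𝔪_O ∩ A₀}` along `O` is defined (`stub_switchingSetup`). [folklore] -/
theorem exists_mem_ne_zero_valuation_lt_one (O : ValuationSubring K) (A₀ : Subalgebra k K)
    (h₀ : A₀.toSubring ≤ O.toSubring)
    (hreg : IsRegularLocalRing (Localization.AtPrime (Ideal.comap (Subring.inclusion h₀) (IsLocalRing.maximalIdeal O))))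
    (hdim : ¬ ringKrullDim (Localization.AtPrime (Ideal.comap (Subring.inclusion h₀) (IsLocalRing.maximalIdeal O))) ≤ 2) :
    ∃ a ∈ A₀, a ≠ 0 ∧ O.valuation a < 1 := by
  classical
  haveI hloc : IsLocalRing (locAtCentre A₀.toSubring O) := isLocalRing_locAtCentre h₀
  have _hreg₀ : IsRegularLocalRing (locAtCentre A₀.toSubring O) := (isRegularLocalRing_locAtCentre_iff h₀).mpr hreg
  -- the local ring of `A₀` at the centre is not a field (it has dimension `> 2`)
  have hnf : ¬ IsField (locAtCentre A₀.toSubring O) := by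
    intro hF
    apply hdim
    have h0 : ringKrullDim (locAtCentre A₀.toSubring O) = 0 := ringKrullDim_eq_zero_of_isField hF
    have h0' : ringKrullDim (Localization.AtPrime (Ideal.comap (Subring.inclusion h₀) (IsLocalRing.maximalIdeal O))) = 0 := by
      rw [← h0]
      exact ringKrullDim_eq_of_ringEquiv (locAtCentreEquiv h₀).toRingEquiv
    rw [h0']
    norm_num
  -- so its maximal ideal has a nonzero element `w = y / z`, `y, z ∈ A₀`, `v(z) = 1`, `v(w) < 1`
  have hne : maximalIdeal (locAtCentre A₀.toSubring O) ≠ ⊥ :=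
    fun h => hnf ((IsLocalRing.isField_iff_maximalIdeal_eq).mpr h)
  obtain ⟨w, hwm, hw0⟩ := Submodule.exists_mem_ne_zero_of_ne_bot hne
  have hvw : O.valuation (w : K) < 1 := (mem_maximalIdeal_locAtCentre_iff h₀ w).mp hwm
  obtain ⟨y, hy, z, hz, hvz, hw⟩ := mem_locAtCentre_iff.mp w.2
  have hz0 : z ≠ 0 := ne_zero_of_valuation_eq_one hvz
  refine ⟨y, hy, ?_, ?_⟩
  · rintro rfl
    apply hw0
    apply Subtype.ext
    change (w : K) = 0
    rw [hw, zero_div]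
  · have : O.valuation (w : K) = O.valuation y := by
      rw [hw, map_div₀, hvz, div_one]
    rwa [← this]

/-! ## The degenerate tail: a member of dimension `≤ 1` -/

/-- **Hull parameter on a stationary DVR tail.** If some member `R i₁` of the point sequence has Krull dimension `≤ 1`, then the
sequence is stationary from `i₁` on, `S = R i₁` is a DVR, and any one-element regular system of parameters `x` of `R i₁` is a hull
parameter: every element of `S` of positive value is divisible by `x` in `S`. OURS. [folklore] -/
theorem exists_isHullParameter_of_ringKrullDim_le_one {O : ValuationSubring K} {A₀ : Subalgebra k K}
    (h₀ : A₀.toSubring ≤ O.toSubring)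
    (hreg : IsRegularLocalRing (Localization.AtPrime (Ideal.comap (Subring.inclusion h₀) (IsLocalRing.maximalIdeal O))))
    {R : ℕ → Subring K} (hseq : IsPointSequenceAlong O A₀ R) {i₁ : ℕ} (hdim : ringKrullDim (R i₁) ≤ 1) :
    ∃ x : K, IsHullParameter O R x := by
  classical
  haveI hregi : IsRegularLocalRing (R i₁) := isRegularLocalRing_of_pointSequence h₀ hreg hseq.1 hseq.2 i₁
  have hconst := eq_of_le_of_ringKrullDim_le_one h₀ hreg hseq.1 hseq.2 hdim
  have hmono : Monotone R := hseq.monotone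
  -- the Shannon extension is `R i₁`
  have hS : shannonExt R = R i₁ := by
    refine le_antisymm (iSup_le fun j => ?_) (le_shannonExt R i₁)
    rcases le_total j i₁ with hj | hj
    · exact hmono hj
    · exact (hconst j hj).le
  -- `R i₁` is a DVR (it has a quadratic transform, so it is not a field)
  haveI hPIR : IsPrincipalIdealRing (R i₁) := isPrincipalIdealRing_of_ringKrullDim_le_one hdim
  obtain ⟨_, x₁, hx₁m, hx₁0, -, -⟩ := (hseq.2 i₁).exists_eq_locAtCentre
  haveI : IsDiscreteValuationRing (R i₁) :=
    { toIsPrincipalIdealRing := hPIR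
      toIsLocalRing := inferInstance
      not_a_field' := fun hbot => hx₁0 (by
        have : x₁ ∈ (⊥ : Ideal (R i₁)) := hbot ▸ hx₁m
        exact (Submodule.mem_bot (R i₁)).mp this) }
  -- a one-element part of a regular system of parameters of `R i₁`
  have hne : maximalIdeal (R i₁) ≠ ⊥ := fun hbot => hx₁0 (by
    have : x₁ ∈ (⊥ : Ideal (R i₁)) := hbot ▸ hx₁m
    exact (Submodule.mem_bot (R i₁)).mp this)
  obtain ⟨z, hz⟩ := exists_isRsopPart_one hne
  have hdom₁ := dominated_of_pointSequence h₀ hseq.1 hseq.2 i₁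
  refine ⟨((z 0 : R i₁) : K), ⟨i₁, inferInstance, z, hz, rfl⟩, ?_⟩
  intro a ha hva
  rw [hS] at ha
  have ham : (⟨a, ha⟩ : R i₁) ∈ maximalIdeal (R i₁) :=
    ((subringDominates_valuationSubring_iff hdom₁.1).mp hdom₁ ⟨a, ha⟩).mpr hva
  obtain ⟨m, s, hs, hmul⟩ := exists_mul_eq_pow_of_isDiscreteValuationRing (hz.ne_zero 0) ham
  refine ⟨m, ?_⟩
  rw [hS]
  have hz0 : ((z 0 : R i₁) : K) ≠ 0 := fun h => hz.ne_zero 0 (Subtype.ext h)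
  have : a ^ m / ((z 0 : R i₁) : K) = s := by
    rw [div_eq_iff hz0, ← hmul, mul_comm]
  rw [this]
  exact hs

/-! ## The dichotomy -/

/-- **`NearFarDichotomy` from HLOST Prop. 3.8** (idea-2 card 3, SUPPORT «in print»; TYPE = the literal body of the sketch's
`def NearFarDichotomy : Prop`, Sketch-idea-2f l.641, over the tree vocabulary `Hull.*`): every finitely generated model `A₀ ⊆ O`,
regular of Krull dimension `> 2` at the centre of `O`, carries a point sequence along `O` and a hull parameter, and a nonzero
radicand `t ^ p ∈ A₀` is then near or far.  CONDITIONAL on the named fact `HeinzerEtAl2015HullParameterExists` (HLOST Prop. 3.8);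
the hypotheses `A₀.FG` and `p` are carried for the literal shape only. OURS. [cite: HeinzerEtAl2015, Prop. 3.8] [folklore] -/
theorem nearFarDichotomy_of_hullParameterExists (hH : HeinzerEtAl2015HullParameterExists.{0}) :
    ∀ (p : ℕ) (k K : Type) [Field k] [Field K] [Algebra k K] (O : ValuationSubring K) (A₀ : Subalgebra k K)
      (h₀ : A₀.toSubring ≤ O.toSubring) (t : K), A₀.FG → t ^ p ∈ A₀ → t ≠ 0 →
      IsRegularLocalRing (Localization.AtPrime (Ideal.comap (Subring.inclusion h₀) (IsLocalRing.maximalIdeal O))) →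
      ¬ ringKrullDim (Localization.AtPrime (Ideal.comap (Subring.inclusion h₀) (IsLocalRing.maximalIdeal O))) ≤ 2 →
      ∃ (R : ℕ → Subring K) (x : K), IsPointSequenceAlong O A₀ R ∧ IsHullParameter O R x ∧
        (IsNear R x (t ^ p) ∨ IsFar R x (t ^ p)) := by
  intro p k K _ _ _ O A₀ h₀ t _hfg htp ht0 hreg hdim
  classical
  -- the point sequence of the base along `O`
  obtain ⟨R, hR0, hstep, hregR, hdomR, -⟩ :=
    stub_switchingSetup k K O A₀ h₀ hreg (exists_mem_ne_zero_valuation_lt_one O A₀ h₀ hreg hdim)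
  have hseq : IsPointSequenceAlong O A₀ R := ⟨hR0, hstep⟩
  -- the radicand lies in the Shannon extension and is nonzero
  have htpS : t ^ p ∈ shannonExt R := by
    refine le_shannonExt R 0 ?_
    rw [hR0]
    exact le_locAtCentre A₀.toSubring O htp
  have htp0 : t ^ p ≠ 0 := pow_ne_zero p ht0
  -- a hull parameter: HLOST Prop. 3.8 in Setting 3.1, or the stationary DVR tail otherwise
  have hx : ∃ x : K, IsHullParameter O R x := by
    by_cases hdim2 : ∀ i, (2 : WithBot ℕ∞) ≤ ringKrullDim (R i)
    · obtain ⟨i, x, hloc, z, hz, hzx, -, hprim⟩ := hH K O R (hregR 0) hdim2 (hdomR 0) hstep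
      have hx0 : x ≠ 0 := by
        rw [← hzx]
        exact fun h => hz.ne_zero 0 (Subtype.ext h)
      refine ⟨x, ⟨i, hloc, z, hz, hzx⟩, fun a ha hva => ?_⟩
      obtain ⟨m, s, hs, hms⟩ := hprim a ha hva
      refine ⟨m, ?_⟩
      have : a ^ m / x = s := by rw [div_eq_iff hx0, hms]
      rw [this]
      exact hs
    · obtain ⟨i₁, hi₁⟩ := not_forall.mp hdim2
      haveI hregi : IsRegularLocalRing (R i₁) := hregR i₁
      have hdim1 : ringKrullDim (R i₁) ≤ 1 := by
        have hfin := (isRegularLocalRing_iff (R i₁)).mp hregi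
        rw [← hfin] at hi₁ ⊢
        have : ¬ (2 : ℕ) ≤ (maximalIdeal (R i₁)).spanFinrank := fun h => hi₁ (by exact_mod_cast h)
        exact_mod_cast (show (maximalIdeal (R i₁)).spanFinrank ≤ 1 by omega)
      exact exists_isHullParameter_of_ringKrullDim_le_one h₀ hreg hseq hdim1
  obtain ⟨x, hx⟩ := hx
  exact ⟨R, x, hseq, hx, isNear_or_isFar R x (t ^ p) htpS htp0⟩

/-! ## The dichotomy, UNCONDITIONALLY (appended after the discharge `heinzerEtAl2015HullParameterExists_holds`, p524441) -/

/-- **`NearFarDichotomy` holds outright** (idea-2 card 3 SUPPORT «in print»; TYPE = the literal body of the sketch's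
`def NearFarDichotomy : Prop` over `Hull.*`): the conditional form `nearFarDichotomy_of_hullParameterExists` fed with the
kernel proof of HLOST Prop. 3.8, `heinzerEtAl2015HullParameterExists_holds` (`…SteerHullParameter.lean`).  Adoption leaf for the
skeleton / sketch: `theorem nearFarDichotomy_holds : NearFarDichotomy := Hull.nearFarDichotomy`. OURS.
[cite: HeinzerEtAl2015, Prop. 3.8] [folklore] -/
theorem nearFarDichotomy :
    ∀ (p : ℕ) (k K : Type) [Field k] [Field K] [Algebra k K] (O : ValuationSubring K) (A₀ : Subalgebra k K)
      (h₀ : A₀.toSubring ≤ O.toSubring) (t : K), A₀.FG → t ^ p ∈ A₀ → t ≠ 0 →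
      IsRegularLocalRing (Localization.AtPrime (Ideal.comap (Subring.inclusion h₀) (IsLocalRing.maximalIdeal O))) →
      ¬ ringKrullDim (Localization.AtPrime (Ideal.comap (Subring.inclusion h₀) (IsLocalRing.maximalIdeal O))) ≤ 2 →
      ∃ (R : ℕ → Subring K) (x : K), IsPointSequenceAlong O A₀ R ∧ IsHullParameter O R x ∧
        (IsNear R x (t ^ p) ∨ IsFar R x (t ^ p)) :=
  nearFarDichotomy_of_hullParameterExists heinzerEtAl2015HullParameterExists_holds

end Summit.ResolutionOfSingularities.ResolutionOfSingularities.Theorems.SwitchingDichotomy.Hull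

end
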